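import Literature.AlgebraicGeometry.Motives.HodgeStructureLefschetzGroupCenterFinite
import HarnessLib

/-!
# `Z(S(A)(ℚ))` IS FINITE IFF THE ROSATI INVOLUTION IS OF THE FIRST KIND ON `C₀ = Z(End⁰(A))` — «`S(A)` semisimple» (types
# I–III) versus «not semisimple» (a factor of type IV) read on the `ℚ`-points of the centre, for every polarized `ℚ`-Hodge
# structure, independently of the polarization; for a field centre `K`: FINITE IFF `K` IS TOTALLY REAL, INFINITE IFF `K` IS CM
# (Milne 1999 §2 Summary p. 652; Moonen–Zarhin 1998 §1 Lemma (1); Lange 2023 Lemmas 2.6.4 / 2.6.6)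

[topic AlgebraicGeometry/Motives]

Layer `Literature/AlgebraicGeometry/Motives`, lane `lit-hodgefound` (Track 2 foundations library; prover seat
`lit-hodgefound-p02`, generation 54, self-proposed row g54-#9). THEOREMS ONLY: no definition, no named fact (net debt `0`),
no instance, no notation.  Sequel of g54-#8 (`Motives/HodgeStructureLefschetzGroupCenterFinite`: `†` trivial on `Z(E_φ)` ⟹
`Z(S(H)(ℚ))` finite of order `2^t`; CM centre ⟹ infinite).  This file proves the CONVERSE and assembles the dichotomy: if `†`
MOVES some central `z₀ ∈ Z(E_φ)` («second kind»; Milne's Summary: type IV is the only type with `S(A)` NOT semisimple;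
Moonen–Zarhin: «For `X` of type 4 […] this is a connected torus of rank `e₀`; in all other cases it is finite»), then
`Z(S(H)(ℚ))` is INFINITE.  Mechanism (Hilbert's Theorem 90 for the quadratic algebra `Z(E_φ) ⊇ Z(E_φ)^†`, made explicit): in
the commutative finite-dimensional `ℚ`-algebra `Z = Z(E_φ)` with the ring involution `σ = †|_Z`, for every `n ∈ ℕ` outside the
finite set of `n` with `p(-n) = 0` (`p` the minimal polynomial of `z₀` over `ℚ`) the element `w_n = n + z₀` is a unit
(`p = (X + n) q + p(-n)`), `u_n = σ(w_n) w_n⁻¹ ∈ Z` satisfies `σ(u_n) u_n = 1`, hence is the underlying endomorphism of a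
central element of `S(H)(ℚ)` (g54-#8 §1, Milne's `S₀`), and `u_n = u_m ⟹ (n - m)(z₀ - σ z₀) = 0 ⟹ n = m`.  Consequences:
`Z(S(H)(ℚ))` is finite iff `†` is the identity on `Z(E_φ)` (iff, for a field centre `K ≅ Z(E_φ)`, `K` is totally real —
the tree's `Polarization.forall_adjointEndAlg_center_eq_self_iff_isTotallyReal`), infinite iff `†` moves a central element
(iff `K` is a CM field — the tree's dichotomy `Polarization.isTotallyReal_or_isCMField_of_ringEquiv_subringCenter`), and the
answer does not depend on the polarization (the tree's `Polarization.forall_adjointEndAlg_center_eq_self_iff_of_polarization`).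

## The sources, verbatim

* J. S. Milne, *Lefschetz classes on abelian varieties*, Duke Math. J. 96 (1999) 639–675 [Milne1999LefschetzClasses] (held
  `paper:doi-10-1215-s0012-7094-99-09620-5`, folios 7, 8, 14): p. 645 L1–L10 "`C₀(A)` […] is a product of fields, each of
  which is either a CM-field or `ℚ`. Every Rosati involution `†` preserves each factor of `C₀(A)` and acts on it as complex
  conjugation. […] `S₀(A)(R) = {γ ∈ C₀(A) ⊗_ℚ R | γ†γ = 1}`"; §2 p. 646 L10–L16 "`K` = the centre of `E` (a field), `F` = the
  subfield of `K` on which the Rosati involutions act trivially […] The field `F` is totally real, and `K` equals `F` except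
  when `A` is of type IV, in which case it is a CM-field of degree 2 over `F`"; §2 Summary p. 652 (table «Type — Group —
  Semisimple»: I `Sp` Yes; II `Sp` Yes; III `O` Yes; IV `GL` No).
* B. J. J. Moonen, Yu. G. Zarhin, *Weil classes on abelian varieties*, J. reine angew. Math. 496 (1998) 83–92
  [MoonenZarhin1998WeilClasses] (held `paper:arxiv-alg-geom_9612017`, chunk p0002 L121–L127): «Lemma. (1) The center of
  `G_div(X)` is the group `U_{K_B}` given by `U_{K_B}(R) = {a ∈ (K_B ⊗_ℚ R)^* ∣ a a† = 1}`. For `X` of type 4 with either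
  `d ≥ 2` or `m ≥ 2` this is a connected torus of rank `e₀`; in all other cases it is finite.»
* H. Lange, *Abelian Varieties over the Complex Numbers* (2023) [Lange2023AbelianVarietiesComplex], §2.6.2 Lemma 2.6.4 (first
  kind: the centre is totally real) and Lemma 2.6.6 (second kind: the centre is a CM field, `′` = complex conjugation).
* S. Lang, *Algebra*, rev. 3rd ed. (2002) [Lang2002], Ch. VI §6 Thm. 6.1 (Hilbert's Theorem 90; the parametrisation `b ↦ b/σ(b)`).

Nearest tree results, BY NAME (other carriers): `Literature/AlgebraicGeometry/HodgeTheory/LefschetzGroupCentreInfiniteOfTypeIVFactor`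
(`finite_center_unitaryCentralizerGroup_iff_hasNoTypeIVFactor`: the `ℂ`-points `Z(S(A)(h)(ℂ))` of a complex abelian variety),
`…/DivisorLefschetzGroupCentreFiniteIffNoTypeIVFactor`; here the abstract polarized `ℚ`-Hodge structure and the `ℚ`-points
`ψ.lefschetzGroup`, with «no factor of type IV» read as «`†` trivial on `Z(E_φ)`» (equivalently each factor of `C₀` totally real).

## Dictionary and what is proved (namespace `Literature.AlgebraicGeometry.Motives.HodgeStructure`)

`S(H)(ℚ) = ψ.lefschetzGroup`, `Z(E_φ) = Subalgebra.center ℚ H.endAlg` (same carrier as `Subring.center H.endAlg`), `†` =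
`ψ.adjoint` on `End_ℚ(V)` / `ψ.adjointEndAlg` on `E_φ`.

* §1 **`Polarization.infinite_center_lefschetzGroup_of_adjoint_ne`** (`z₀ ∈ Z(E_φ)`, `z₀† ≠ z₀` ⟹ `Z(S(H)(ℚ))` infinite).
* §2 **`Polarization.finite_center_lefschetzGroup_iff`** (finite iff `†` is the identity on `Z(E_φ)`),
  **`Polarization.infinite_center_lefschetzGroup_iff`** (infinite iff `†` moves a central element),
  `Polarization.finite_center_lefschetzGroup_iff_of_polarization` (independent of the polarization).
* §3 FIELD CENTRE `K ≅ Z(E_φ)`: **`Polarization.finite_center_lefschetzGroup_iff_isTotallyReal`** (finite iff `K` totally real —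
  types I–III), **`Polarization.infinite_center_lefschetzGroup_iff_isCMField`** (infinite iff `K` is CM — type IV).
-/

noncomputable section

open NumberField Polynomial

namespace Literature.AlgebraicGeometry.Motives

namespace HodgeStructure

universe u

variable {V : Type u} [AddCommGroup V] [Module ℚ V] [Module.Finite ℚ V] {n : ℤ} {H : HodgeStructure V n}

omit [Module.Finite ℚ V] in
/-- The two spellings of the centre of `E_φ` have the same members. [folklore] -/
private theorem mem_center_iff_mem_subringCenter₅₄₉ (z : H.endAlg) :
    z ∈ Subalgebra.center ℚ H.endAlg ↔ z ∈ Subring.center H.endAlg := by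
  rw [Subalgebra.mem_center_iff, Subring.mem_center_iff]

/-- The two spellings of «`†` is the identity on the centre». [folklore] -/
private theorem Polarization.forall_adjoint_eq_self_iff₅₄₉ (ψ : Polarization H) :
    (∀ z : H.endAlg, z ∈ Subalgebra.center ℚ H.endAlg → ψ.adjoint (z : Module.End ℚ V) = z) ↔
      ∀ z : Subring.center H.endAlg, ψ.adjointEndAlg z = z := by
  constructor
  · intro h z
    apply Subtype.ext
    rw [ψ.coe_adjointEndAlg_apply]
    exact h z ((mem_center_iff_mem_subringCenter₅₄₉ _).2 z.2)
  · intro h z hz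
    rw [← ψ.coe_adjointEndAlg_apply]
    exact congrArg (fun a : H.endAlg => (a : Module.End ℚ V)) (h ⟨z, (mem_center_iff_mem_subringCenter₅₄₉ z).1 hz⟩)

/-! ## §1 `†` of the second kind on `C₀` ⟹ `Z(S(H)(ℚ))` is infinite -/

omit [Module.Finite ℚ V] in
/-- HILBERT 90, MADE EXPLICIT, in a commutative `ℚ`-algebra `Z` with a ring involution `σ`: if `σ` moves an algebraic
element `z₁`, there are infinitely many `u = σ(w)/w` with `σ(u) u = 1` — for the cofinitely many `n ∈ ℕ` with `p(-n) ≠ 0`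
(`p` the minimal polynomial of `z₁`) the element `w_n = n + z₁` is a unit (`p = (X + n) q_n + p(-n)`), `u_n = σ(w_n) w_n⁻¹`,
and `u_n = u_m ⟹ (n - m)(z₁ - σ z₁) = 0 ⟹ n = m`. [cite: Lang2002, Ch. VI §6 Thm. 6.1] -/
private theorem exists_infinite_injOn_norm_one₅₄₉ {Z : Type*} [CommRing Z] [Algebra ℚ Z] (σ : Z →+* Z)
    (hσσ : ∀ z, σ (σ z) = z) {z₁ : Z} (hint : IsIntegral ℚ z₁) (hne : σ z₁ ≠ z₁) :
    ∃ (S : Set ℕ) (u : ℕ → Z), S.Infinite ∧ (∀ m ∈ S, σ (u m) * u m = 1) ∧ Set.InjOn u S := by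
  classical
  have hp0 : minpoly ℚ z₁ ≠ 0 := minpoly.ne_zero hint
  have hpz : aeval z₁ (minpoly ℚ z₁) = 0 := minpoly.aeval ℚ z₁
  -- the bad `n` (those with `p(-n) = 0`) are finitely many
  have hB : {m : ℕ | (minpoly ℚ z₁).eval (-(m : ℚ)) = 0}.Finite := by
    have h : Set.InjOn (fun m : ℕ => -(m : ℚ)) ((fun m : ℕ => -(m : ℚ)) ⁻¹' {x : ℚ | (minpoly ℚ z₁).IsRoot x}) :=
      fun a _ b _ hab => Nat.cast_injective (neg_injective hab)
    exact (Polynomial.finite_setOf_isRoot hp0).preimage h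
  -- division with remainder: `(n + z₁) q_n + p(-n) = 0`
  have hdiv : ∀ m : ℕ, ∃ q : Z, ((m : Z) + z₁) * q + algebraMap ℚ Z ((minpoly ℚ z₁).eval (-(m : ℚ))) = 0 := by
    intro m
    refine ⟨aeval z₁ (minpoly ℚ z₁ /ₘ (X - C (-(m : ℚ)))), ?_⟩
    have h := congrArg (aeval z₁) ((minpoly ℚ z₁).modByMonic_add_div (X - C (-(m : ℚ))))
    rw [Polynomial.modByMonic_X_sub_C_eq_C_eval] at h
    generalize minpoly ℚ z₁ /ₘ (X - C (-(m : ℚ))) = q at h ⊢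
    rw [map_add, map_mul, map_sub, aeval_X, aeval_C, aeval_C, hpz, map_neg, map_natCast, sub_neg_eq_add] at h
    linear_combination h
  choose q hq using hdiv
  -- the units `w_n = n + z₁` (good `n`), their inverses `v_n`, and the norm-one elements `u_n = σ(w_n) v_n`
  obtain ⟨w, hw⟩ : ∃ w : ℕ → Z, ∀ m, w m = (m : Z) + z₁ := ⟨_, fun _ => rfl⟩
  obtain ⟨v, hv⟩ : ∃ v : ℕ → Z, ∀ m, v m = -(algebraMap ℚ Z ((minpoly ℚ z₁).eval (-(m : ℚ)))⁻¹) * q m :=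
    ⟨_, fun _ => rfl⟩
  have hwv : ∀ m : ℕ, (minpoly ℚ z₁).eval (-(m : ℚ)) ≠ 0 → w m * v m = 1 := by
    intro m hm
    have h1 : w m * q m = -algebraMap ℚ Z ((minpoly ℚ z₁).eval (-(m : ℚ))) := by
      rw [hw]
      exact eq_neg_of_add_eq_zero_left (hq m)
    calc w m * v m = -(algebraMap ℚ Z ((minpoly ℚ z₁).eval (-(m : ℚ)))⁻¹) * (w m * q m) := by
          rw [hv]; ring
      _ = algebraMap ℚ Z ((minpoly ℚ z₁).eval (-(m : ℚ)))⁻¹ * algebraMap ℚ Z ((minpoly ℚ z₁).eval (-(m : ℚ))) := by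
          rw [h1]; ring
      _ = 1 := by rw [← map_mul, inv_mul_cancel₀ hm, map_one]
  have hσw : ∀ m : ℕ, σ (w m) = (m : Z) + σ z₁ := fun m => by
    rw [hw, σ.map_add, map_natCast]
  refine ⟨{m : ℕ | (minpoly ℚ z₁).eval (-(m : ℚ)) = 0}ᶜ, fun m => σ (w m) * v m, hB.infinite_compl, ?_, ?_⟩
  · -- `σ(u_n) u_n = (w_n v_n) σ(v_n w_n) = 1`
    intro m hm
    have h1 := hwv m hm
    change σ (σ (w m) * v m) * (σ (w m) * v m) = 1
    rw [σ.map_mul (σ (w m)) (v m), hσσ]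
    calc w m * σ (v m) * (σ (w m) * v m) = (w m * v m) * (σ (v m) * σ (w m)) := by ring
      _ = 1 := by rw [h1, ← σ.map_mul (v m) (w m), mul_comm (v m) (w m), h1, σ.map_one, one_mul]
  · -- `u_a = u_b ⟹ σ(w_a) w_b = σ(w_b) w_a ⟹ (a - b)(z₁ - σ z₁) = 0 ⟹ a = b`
    intro a ha b hb hab
    change σ (w a) * v a = σ (w b) * v b at hab
    have ha' := hwv a ha
    have hb' := hwv b hb
    have hmul : σ (w a) * w b = σ (w b) * w a := by
      calc σ (w a) * w b = σ (w a) * w b * (w a * v a) := by rw [ha', mul_one]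
        _ = σ (w a) * v a * (w a * w b) := by ring
        _ = σ (w b) * v b * (w a * w b) := by rw [hab]
        _ = σ (w b) * w a * (w b * v b) := by ring
        _ = σ (w b) * w a := by rw [hb', mul_one]
    rw [hσw, hσw, hw, hw] at hmul
    have hkey : ((a : Z) - (b : Z)) * (z₁ - σ z₁) = 0 := by linear_combination hmul
    by_contra habne
    have hab' : (a : ℚ) - (b : ℚ) ≠ 0 := sub_ne_zero.2 fun h => habne (Nat.cast_injective h)
    have hU : IsUnit ((a : Z) - (b : Z)) := by
      rw [← map_natCast (algebraMap ℚ Z) a, ← map_natCast (algebraMap ℚ Z) b, ← map_sub]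
      exact (isUnit_iff_ne_zero.2 hab').map _
    obtain ⟨c, hc⟩ := hU
    rw [← hc] at hkey
    exact hne (sub_eq_zero.1 ((Units.mul_right_eq_zero c).1 hkey)).symm

/-- **A ROSATI INVOLUTION OF THE SECOND KIND ON `C₀` MAKES THE CENTRE OF `S(A)(ℚ)` INFINITE** («`S(A)` not semisimple» for
type IV; Moonen–Zarhin: «a connected torus»): if `†` moves some `z₀ ∈ Z(E_φ)`, then `Z(S(H)(ℚ))` is infinite — `†` restricts
to a ring involution `σ` of the commutative finite-dimensional `ℚ`-algebra `Z(E_φ)`, the elements `u_n = σ(n + z₀)/(n + z₀)`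
(`n ∈ ℕ` outside a finite set) are pairwise distinct with `σ(u_n) u_n = 1`, and each is the underlying endomorphism of a
central element of `S(H)(ℚ)` (g54-#8 `Polarization.exists_mem_center_lefschetzGroup_coe_eq`, Milne's `S₀`).
[cite: Milne1999LefschetzClasses, §1 p. 645 L1–L10 and §2 Summary p. 652] [cite: MoonenZarhin1998WeilClasses, §1 Lemma (1)]
[cite: Lang2002, Ch. VI §6 Thm. 6.1] -/
theorem Polarization.infinite_center_lefschetzGroup_of_adjoint_ne (ψ : Polarization H) {z₀ : H.endAlg}
    (hz₀ : z₀ ∈ Subalgebra.center ℚ H.endAlg) (hne : ψ.adjoint (z₀ : Module.End ℚ V) ≠ z₀) :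
    Infinite (Subgroup.center ψ.lefschetzGroup) := by
  classical
  -- `σ = †` on the commutative `ℚ`-algebra `Z = Z(E_φ)`, as a ring endomorphism with `σ ∘ σ = id`
  have hmemσ : ∀ z : Subalgebra.center ℚ H.endAlg, ψ.adjointEndAlg z ∈ Subalgebra.center ℚ H.endAlg := fun z =>
    (mem_center_iff_mem_subringCenter₅₄₉ _).2
      (ψ.adjointEndAlg_mem_subringCenter ((mem_center_iff_mem_subringCenter₅₄₉ _).1 z.2))
  let σ : Subalgebra.center ℚ H.endAlg →+* Subalgebra.center ℚ H.endAlg :=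
    { toFun := fun z => ⟨ψ.adjointEndAlg z, hmemσ z⟩
      map_one' := by
        apply Subtype.ext
        apply Subtype.ext
        show ((ψ.adjointEndAlg (1 : H.endAlg) : H.endAlg) : Module.End ℚ V) = ((1 : H.endAlg) : Module.End ℚ V)
        rw [ψ.coe_adjointEndAlg_apply, OneMemClass.coe_one, ψ.adjoint_one]
      map_mul' := fun a b => by
        apply Subtype.ext
        show ψ.adjointEndAlg ((a : H.endAlg) * b) = ψ.adjointEndAlg a * ψ.adjointEndAlg b
        rw [ψ.isAntiInvolution_adjointEndAlg.map_mul]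
        exact Subalgebra.mem_center_iff.1 (hmemσ a) (ψ.adjointEndAlg b)
      map_zero' := Subtype.ext (map_zero ψ.adjointEndAlg)
      map_add' := fun a b => Subtype.ext (map_add ψ.adjointEndAlg (a : H.endAlg) b) }
  have hσσ : ∀ z, σ (σ z) = z := fun z => Subtype.ext (ψ.isAntiInvolution_adjointEndAlg.apply_apply (z : H.endAlg))
  have hσcoe : ∀ z : Subalgebra.center ℚ H.endAlg,
      (((σ z : Subalgebra.center ℚ H.endAlg) : H.endAlg) : Module.End ℚ V) =
        ψ.adjoint ((z : H.endAlg) : Module.End ℚ V) := fun z => ψ.coe_adjointEndAlg_apply z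
  -- the central element `z₁ = z₀`, moved by `σ`, algebraic over `ℚ`
  let z₁ : Subalgebra.center ℚ H.endAlg := ⟨z₀, hz₀⟩
  have hne₁ : σ z₁ ≠ z₁ := fun h => hne (by rw [← hσcoe z₁, h])
  haveI : Module.Finite ℚ H.endAlg := finite_endAlg H
  have hint : IsIntegral ℚ z₁ :=
    (isIntegral_algHom_iff (Subalgebra.center ℚ H.endAlg).val Subtype.val_injective).1 (IsIntegral.of_finite ℚ z₀)
  -- Hilbert 90: infinitely many `u ∈ Z` with `σ(u) u = 1`, each the underlying endomorphism of a central `γ ∈ S(H)(ℚ)`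
  obtain ⟨S, u, hS, hu, hinj⟩ :=
    exists_infinite_injOn_norm_one₅₄₉ (Z := Subalgebra.center ℚ H.endAlg) σ hσσ hint hne₁
  haveI : Infinite S := hS.to_subtype
  have hγ : ∀ m : S, ∃ γ : Subgroup.center ψ.lefschetzGroup,
      (((γ : ψ.lefschetzGroup) : V ≃ₗ[ℚ] V) : Module.End ℚ V) = ((u m : H.endAlg) : Module.End ℚ V) := by
    intro m
    have hunit : ψ.adjoint ((u m : H.endAlg) : Module.End ℚ V) * ((u m : H.endAlg) : Module.End ℚ V) = 1 := by
      rw [← hσcoe, ← Subalgebra.coe_mul, ← Subalgebra.coe_mul, hu m m.2, OneMemClass.coe_one, OneMemClass.coe_one]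
    obtain ⟨γ, hγc, hγu⟩ := ψ.exists_mem_center_lefschetzGroup_coe_eq (u m).2 hunit
    exact ⟨⟨γ, hγc⟩, hγu⟩
  choose F hF using hγ
  refine Infinite.of_injective F fun a b hab => Subtype.ext (hinj a.2 b.2 ?_)
  apply Subtype.ext
  apply Subtype.ext
  rw [← hF a, ← hF b, hab]

/-! ## §2 The dichotomy: finite iff first kind, infinite iff second kind; polarization-free -/

/-- **`Z(S(A)(ℚ))` IS FINITE IFF `†` IS OF THE FIRST KIND ON `C₀`** («Semisimple: Yes» exactly for types I, II, III; «in all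
other cases it is finite»): the centre of `S(H)(ℚ)` is finite iff the Rosati involution is the identity on `Z(E_φ)` (⟸ g54-#8,
of order `2^t`; ⟹ §1). [cite: Milne1999LefschetzClasses, §2 Summary p. 652] [cite: MoonenZarhin1998WeilClasses, §1 Lemma (1)]
[cite: Lange2023AbelianVarietiesComplex, §2.6.2 Lemma 2.6.4 and Lemma 2.6.6] -/
theorem Polarization.finite_center_lefschetzGroup_iff (ψ : Polarization H) :
    Finite (Subgroup.center ψ.lefschetzGroup) ↔
      ∀ z : H.endAlg, z ∈ Subalgebra.center ℚ H.endAlg → ψ.adjoint (z : Module.End ℚ V) = z := by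
  refine ⟨fun hfin z hz => ?_, ψ.finite_center_lefschetzGroup_of_forall_adjoint_eq_self⟩
  by_contra hne
  haveI := ψ.infinite_center_lefschetzGroup_of_adjoint_ne hz hne
  exact not_finite (Subgroup.center ψ.lefschetzGroup)

/-- **`Z(S(A)(ℚ))` IS INFINITE IFF `†` MOVES A CENTRAL ELEMENT** (second kind on some factor of `C₀` — a factor of type IV;
«a connected torus of rank `e₀`» in Moonen–Zarhin). [cite: Milne1999LefschetzClasses, §2 Summary p. 652]
[cite: MoonenZarhin1998WeilClasses, §1 Lemma (1)] [cite: Lange2023AbelianVarietiesComplex, §2.6.2 Lemma 2.6.6] -/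
theorem Polarization.infinite_center_lefschetzGroup_iff (ψ : Polarization H) :
    Infinite (Subgroup.center ψ.lefschetzGroup) ↔
      ∃ z : H.endAlg, z ∈ Subalgebra.center ℚ H.endAlg ∧ ψ.adjoint (z : Module.End ℚ V) ≠ z := by
  rw [← not_finite_iff_infinite, ψ.finite_center_lefschetzGroup_iff, not_forall]
  exact exists_congr fun z => Classical.not_imp

/-- **FINITENESS OF `Z(S(A)(ℚ))` DOES NOT DEPEND ON THE POLARIZATION** («the restriction of `†` to the centre is independent of
the choice of `D`»: the tree's `Polarization.forall_adjointEndAlg_center_eq_self_iff_of_polarization`) — «`S(A)` is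
semisimple» is a property of `A`. [cite: Milne1999LefschetzClasses, §1 p. 643 L1–L2 and §2 Summary p. 652] -/
theorem Polarization.finite_center_lefschetzGroup_iff_of_polarization (ψ₁ ψ₂ : Polarization H) :
    Finite (Subgroup.center ψ₁.lefschetzGroup) ↔ Finite (Subgroup.center ψ₂.lefschetzGroup) := by
  rw [ψ₁.finite_center_lefschetzGroup_iff, ψ₂.finite_center_lefschetzGroup_iff, ψ₁.forall_adjoint_eq_self_iff₅₄₉,
    ψ₂.forall_adjoint_eq_self_iff₅₄₉]
  exact ψ₁.forall_adjointEndAlg_center_eq_self_iff_of_polarization ψ₂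

/-! ## §3 A centre which is a field `K`: finite iff `K` is totally real, infinite iff `K` is CM -/

section CentreField

variable {K : Type*} [Field K] [NumberField K]

/-- **FIELD CENTRE: `Z(S(A)(ℚ))` IS FINITE IFF `K = Z(End⁰(A))` IS TOTALLY REAL** (types I–III: «`K` equals `F`», `F` totally
real; the tree's `Polarization.forall_adjointEndAlg_center_eq_self_iff_isTotallyReal`). [cite: Milne1999LefschetzClasses, §2 p. 646 L10–L16 and Summary p. 652]
[cite: Lange2023AbelianVarietiesComplex, §2.6.2 Lemma 2.6.4] [cite: MoonenZarhin1998WeilClasses, §1 Lemma (1)] -/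
theorem Polarization.finite_center_lefschetzGroup_iff_isTotallyReal (ψ : Polarization H)
    (g : K ≃+* Subring.center H.endAlg) : Finite (Subgroup.center ψ.lefschetzGroup) ↔ IsTotallyReal K := by
  rw [ψ.finite_center_lefschetzGroup_iff, ψ.forall_adjoint_eq_self_iff₅₄₉]
  exact ψ.forall_adjointEndAlg_center_eq_self_iff_isTotallyReal g

/-- **FIELD CENTRE: `Z(S(A)(ℚ))` IS INFINITE IFF `K = Z(End⁰(A))` IS A CM FIELD** (type IV: «in which case it is a CM-field of
degree 2 over `F`»; the centre is totally real or CM — the tree's `Polarization.isTotallyReal_or_isCMField_of_ringEquiv_subringCenter`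
— and a CM field is not totally real). [cite: Milne1999LefschetzClasses, §2 p. 646 L10–L16 and Summary p. 652]
[cite: Lange2023AbelianVarietiesComplex, §2.6.2 Lemma 2.6.6] [cite: MoonenZarhin1998WeilClasses, §1 Lemma (1)] -/
theorem Polarization.infinite_center_lefschetzGroup_iff_isCMField (ψ : Polarization H)
    (g : K ≃+* Subring.center H.endAlg) : Infinite (Subgroup.center ψ.lefschetzGroup) ↔ IsCMField K := by
  rw [← not_finite_iff_infinite, ψ.finite_center_lefschetzGroup_iff_isTotallyReal g]
  constructor
  · intro h
    exact (ψ.isTotallyReal_or_isCMField_of_ringEquiv_subringCenter g).resolve_left h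
  · intro hCM hTR
    obtain ⟨w⟩ := (inferInstance : Nonempty (InfinitePlace K))
    exact InfinitePlace.not_isReal_iff_isComplex.2 (hCM.to_isTotallyComplex.isComplex w) (hTR.isReal w)

end CentreField

end HodgeStructure

end Literature.AlgebraicGeometry.Motives
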